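import Summits.BirchSwinnertonDyer.BirchSwinnertonDyer.Theorems.EisensteinPrimesCharLocalTameCount
import Literature.NumberTheory.GaloisRepresentations.GaloisCohomologyLocalizationTransport
import HarnessLib

/-!
# KY / CGLS Lemma 1.1.1 per place of `K_∞`, LOWER-bound half, in the GLOBAL currency:
# `corank_{ℤ_p} H¹(ker κ ⊓ D_v, (F/𝒪)(θ)) = 1` when `θ(Frob_v) ≡ Nv (mod 𝔭)` (`v ∤ p` finitely decomposed)

Cell `bsd-eis` (home `run/shared/lean/pub/bsd-eis/`), seat `bsd-line-x1-p1-w2` (gen 1; D-0154 width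
seat on crux 2 `GoodLatticeBDPValue` = stmt-BirchSwinnertonDyer-19032, line `halves` v16, stub
`stub_imprimCorank` = `KellerYin2024.prop125_residualPair_unrSelmer_corank_ge`). Sequel of
`EisensteinPrimesCharLocalTameCount` (the computation in the local currency
`Hi = Gal(K̄_v/K_{∞,w}) ≤ Γ_{K_v}`). Both derivations of the `≥` half of the `S`-relaxation corank
identity (LEAD verdict v3.1 §3: road (A) via Greenberg 2016 Prop. 2.6.3 + Shapiro, road (B) via
Pollack–Weston 2011 Prop. A.2 whose `ℋ_v` is built on `PollackWeston2011.localH1 H M v =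
subgroupH1 (H ⊓ decomp v) M`) read the local factor at `w ∈ Sf` in the GLOBAL currency
`H¹(ker κ ⊓ D_v, M)` — the target of `GreenbergSelmer.awayKer` and PW's `localH1`. This file
transports the local result there:

* §1 `nonempty_addEquiv_subgroupH1_inf_decomp` — GENERIC (any subgroup `H ≤ Γ_K`, any discrete
  `Γ_K`-module `M`, any finite `v`): **`H¹(H ⊓ D_v, M) ≃+ H¹(localSubgroup H K_v, M)`** (the two
  inflations along the mutually inverse isomorphisms `res : Gal(K̄_v/K_v)|_{H} ⥲ H ⊓ D_v`,
  `absGaloisRangeEquivCompletion`; the transport used inline in the tree's UTD files, recorded once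
  as a statement), hence `zpCorank_subgroupH1_inf_decomp_eq`; and the tautological
  `nonempty_addEquiv_subgroupH1_kerD` : `H¹(kerD κ v, M) ≃+ H¹(ker κ ⊓ D_v, M)` (the currency of the
  UTD Σ-local files, `X11b.Coinv.kerD`), hence `zpCorank_subgroupH1_kerD_eq`.
* §2 **`zpCorank_localH1_charModule_eq_one`** — for any `ℤ_p`-extension `κ`, `v ∤ p` with
  `D_v ⊄ ker κ` (finitely decomposed), `θ^{p−1} = 1` and `FrobActsAsNormAt ∅ θ v`:
  **`zpCorank (subgroupH1 (κ.kerSubgroup ⊓ decomp v) (charModule ∅ θ)) p = 1`**; and the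
  unconditional-in-`θ` form **`ite_le_zpCorank_localH1_charModule`**:
  `𝟙[FrobActsAsNormAt ∅ θ v] ≤ zpCorank (subgroupH1 (κ.kerSubgroup ⊓ decomp v) (charModule ∅ θ)) p`
  — the per-place LOWER bound `corank ℋ_w ≥ 𝟙[θ(Frob_w) ≡ Nw]` of KY Lemma 1.1.1 (one unit of
  corank at each of the `[Γ:Γ_w] = numPlacesAbove κ w` places of `K_∞` above `w`, read at the
  chosen place; the other places are its `conj_{γ^i}`-translates), complementing the tree's upper
  bound `CharLocalInertiaFrobenius.zpCorank_le_ite_of_forall_exists` (p609213); `kerD` twins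
  `zpCorank_subgroupH1_kerD_charModule_eq_one`, `ite_le_zpCorank_subgroupH1_kerD_charModule`.
* §3 `exists_nsmul_eq_localH1_charModule` — `H¹(ker κ ⊓ D_v, (F/𝒪)(θ))` is `p`-divisible (so the
  unramified/finite local condition there has divisible quotient; "`μ(𝒫_w) = 0`").

HONEST FRAMING: tool theorems only (no definition, no named fact, no `sorry`); closes nothing by
itself (`--supports stmt-BirchSwinnertonDyer-19032`); BSD / Mazur's main conjecture / IMC is proved
for no curve by this file.

References: Keller–Yin arXiv:2402.12781v2 Lemma 1.1.1 (TeX L455–462), Prop. 1.2.5; Castella–Grossi–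
Lee–Skinner, Invent. Math. 227 (2022) Lemma 1.1.1; Greenberg–Vatsal, Invent. Math. 142 (2000) §2
Prop. (2.4); Pollack–Weston, Compositio 147 (2011) App. A (the `ℋ_v` object); Neukirch, ANT II (9.6).
-/

-- `Summit.BirchSwinnertonDyer.BirchSwinnertonDyer.…`: summit and sub-problem share a name (D-0017 layout).
set_option linter.dupNamespace false
set_option autoImplicit false

noncomputable section

open scoped Classical AddSubgroup Pointwise

open CategoryTheory Function Filter Polynomial NumberField IsDedekindDomain Field ValuativeRel WeierstrassCurve
open Literature.NumberTheory.EllipticCurves Literature.NumberTheory.EllipticCurves.GreenbergSelmer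
  Literature.NumberTheory.GaloisRepresentations
  Literature.NumberTheory.GaloisRepresentations.IsNonarchimedeanLocalField
  Literature.NumberTheory.EllipticCurves.KellerYin2024 Literature.NumberTheory.IwasawaTheory
  IsDedekindDomain.HeightOneSpectrum
  Summit.BirchSwinnertonDyer.Rank1Residual
  Summit.BirchSwinnertonDyer.Rank1Residual.X2.NonPrimitiveQuotientCorank
  Summit.BirchSwinnertonDyer.Rank1Residual.Iwasawa.NonsplitTower
  Summit.BirchSwinnertonDyer.Rank1Residual.X11b.Coinv
  Summit.BirchSwinnertonDyer.BirchSwinnertonDyer.Theorems.CharLocalTameCount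

namespace Summit.BirchSwinnertonDyer.BirchSwinnertonDyer.Theorems.CharLocalTameCorank

variable {K : Type} [Field K] [NumberField K]

/-! ## §1 `H¹(H ⊓ D_v, M) ≃+ H¹(Gal(K̄_v/K_v)|_H, M)` (generic transport) -/

/-- **`H¹(H ⊓ D_v, M) ≃+ H¹(localSubgroup H K_v, M)`** for any subgroup `H ≤ Γ_K`, any discrete
`Γ_K`-module `M` (with `Γ_{K_v}` acting through the chosen embedding, `absGaloisRestrict`) and any
finite place `v`: restriction to the completion is a topological isomorphism `Γ_{K_v} ⥲ D_v`
(`absGaloisRangeEquivCompletion`, Neukirch II (9.6)) carrying `localSubgroup H K_v = res⁻¹(H)` onto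
`H ⊓ D_v`, and the two inflations along it and its inverse are mutually inverse on `H¹`.
[cite: NeukirchANT1999, Ch. II §9 Prop. (9.6)] [cite: SerreGaloisCohomology1997, I §2.4] -/
theorem nonempty_addEquiv_subgroupH1_inf_decomp (H : Subgroup (absoluteGaloisGroup K))
    (M : Type) [AddCommGroup M] [DistribMulAction (absoluteGaloisGroup K) M] [TopologicalSpace M]
    [DiscreteTopology M] (v : HeightOneSpectrum (𝓞 K)) :
    letI : DistribMulAction (absoluteGaloisGroup (v.adicCompletion K)) M :=
      DistribMulAction.compHom _ (absGaloisRestrict K (v.adicCompletion K)).toMonoidHom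
    Nonempty (Literature.NumberTheory.EllipticCurves.subgroupH1 (H ⊓ decomp v) M ≃+
      Literature.NumberTheory.EllipticCurves.subgroupH1
        (localSubgroup H (v.adicCompletion K)) M) := by
  letI inst : DistribMulAction (absoluteGaloisGroup (v.adicCompletion K)) M :=
    DistribMulAction.compHom _ (absGaloisRestrict K (v.adicCompletion K)).toMonoidHom
  -- notation
  let Fv := v.adicCompletion K
  let G : Type := absoluteGaloisGroup Fv
  let Hi : Subgroup G := localSubgroup H Fv
  let D : Subgroup (absoluteGaloisGroup K) := H ⊓ decomp v
  haveI : CharZero Fv := charZero_of_injective_algebraMap (algebraMap K Fv).injective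
  -- `θ₁ : Hi → D`, `x ↦ res x`
  let θ₁ : Hi →ₜ* D :=
    { toFun := fun x ↦ ⟨absGaloisRestrict K Fv x, Subgroup.mem_inf.mpr ⟨by
          have h := (mem_localSubgroup_iff H Fv x.1).mp x.2
          rwa [resGal_eq_absGaloisRestrict] at h, (mem_decomp_iff v _).mpr ⟨x, rfl⟩⟩⟩
      map_one' := Subtype.ext (by simp)
      map_mul' := fun x y ↦ Subtype.ext (by simp)
      continuous_toFun :=
        ((absGaloisRestrict K Fv).continuous_toFun.comp continuous_subtype_val).subtype_mk _ }
  -- `θ₂ : D → Hi`, `x ↦ res⁻¹ x`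
  let e := absGaloisRangeEquivCompletion K v
  have hDr : ∀ x : D, (x : absoluteGaloisGroup K) ∈ (absGaloisRestrict K Fv).range := fun x ↦
    (Subgroup.mem_inf.mp x.2).2
  have hmemHi : ∀ x : D, e.symm ⟨x.1, hDr x⟩ ∈ Hi := fun x ↦ by
    show e.symm ⟨x.1, hDr x⟩ ∈ localSubgroup H Fv
    rw [mem_localSubgroup_iff, resGal_eq_absGaloisRestrict,
      absGaloisRestrict_absGaloisRangeEquivCompletion_symm]
    exact (Subgroup.mem_inf.mp x.2).1
  let θ₂ : D →ₜ* Hi :=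
    { toFun := fun x ↦ ⟨e.symm ⟨x.1, hDr x⟩, hmemHi x⟩
      map_one' := Subtype.ext (by
        show e.symm ⟨((1 : D) : absoluteGaloisGroup K), hDr 1⟩ = 1
        rw [← map_one e.symm]
        rfl)
      map_mul' := fun x y ↦ Subtype.ext (by
        show e.symm ⟨((x * y : D) : absoluteGaloisGroup K), hDr (x * y)⟩ =
          e.symm ⟨(x : absoluteGaloisGroup K), hDr x⟩ * e.symm ⟨(y : absoluteGaloisGroup K), hDr y⟩
        rw [← map_mul e.symm]
        rfl)
      continuous_toFun :=
        (e.symm.continuous.comp (continuous_subtype_val.subtype_mk fun x ↦ hDr x)).subtype_mk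
          fun x ↦ hmemHi x }
  have hθ₂res : ∀ x : D, absGaloisRestrict K Fv (θ₂ x : G) = (x : absoluteGaloisGroup K) := fun x ↦
    absGaloisRestrict_absGaloisRangeEquivCompletion_symm K v ⟨x.1, hDr x⟩
  -- mutually inverse
  have hθ₁₂ : θ₁.comp θ₂ = ContinuousMonoidHom.id D :=
    ContinuousMonoidHom.ext fun x ↦ Subtype.ext (hθ₂res x)
  have hθ₂₁ : θ₂.comp θ₁ = ContinuousMonoidHom.id Hi := by
    refine ContinuousMonoidHom.ext fun y ↦ Subtype.ext ?_
    show e.symm ⟨absGaloisRestrict K Fv y, hDr (θ₁ y)⟩ = (y : G)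
    have : (⟨absGaloisRestrict K Fv y, hDr (θ₁ y)⟩ : (absGaloisRestrict K Fv).range) = e y :=
      Subtype.ext rfl
    rw [this, ContinuousMulEquiv.symm_apply_apply]
  -- the two inflations
  have h₂ : ∀ (x : D) (m : M), (AddMonoidHom.id M) (θ₂ x • m) = x • (AddMonoidHom.id M) m :=
    fun x m ↦ by
      change absGaloisRestrict K Fv (θ₂ x : G) • m = (x : absoluteGaloisGroup K) • m
      rw [hθ₂res]
  let r₁ := resH1Hom θ₁ (AddMonoidHom.id M) fun _ _ ↦ rfl
  let r₂ := resH1Hom θ₂ (AddMonoidHom.id M) h₂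
  have h21 : r₂.comp r₁ = AddMonoidHom.id _ := by
    rw [resH1Hom_comp, resH1Hom_congr hθ₁₂ (AddMonoidHom.comp_id _) _ (fun _ _ ↦ rfl), resH1Hom_id]
  have h12 : r₁.comp r₂ = AddMonoidHom.id _ := by
    rw [resH1Hom_comp, resH1Hom_congr hθ₂₁ (AddMonoidHom.comp_id _) _ (fun _ _ ↦ rfl), resH1Hom_id]
  exact ⟨{ toFun := r₁
           invFun := r₂
           left_inv := fun x ↦ DFunLike.congr_fun h21 x
           right_inv := fun y ↦ DFunLike.congr_fun h12 y
           map_add' := fun x y ↦ map_add r₁ x y }⟩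

/-- **`corank_{ℤ_p} H¹(H ⊓ D_v, M) = corank_{ℤ_p} H¹(localSubgroup H K_v, M)`** (invariance of the
corank formula under the transport `nonempty_addEquiv_subgroupH1_inf_decomp`).
[cite: NeukirchANT1999, Ch. II §9 Prop. (9.6)] -/
theorem zpCorank_subgroupH1_inf_decomp_eq (H : Subgroup (absoluteGaloisGroup K))
    (M : Type) [AddCommGroup M] [DistribMulAction (absoluteGaloisGroup K) M] [TopologicalSpace M]
    [DiscreteTopology M] (v : HeightOneSpectrum (𝓞 K)) (p : ℕ) :
    letI : DistribMulAction (absoluteGaloisGroup (v.adicCompletion K)) M :=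
      DistribMulAction.compHom _ (absGaloisRestrict K (v.adicCompletion K)).toMonoidHom
    zpCorank (Literature.NumberTheory.EllipticCurves.subgroupH1 (H ⊓ decomp v) M) p =
      zpCorank (Literature.NumberTheory.EllipticCurves.subgroupH1
        (localSubgroup H (v.adicCompletion K)) M) p := by
  obtain ⟨e⟩ := nonempty_addEquiv_subgroupH1_inf_decomp H M v
  exact zpCorank_congr e p

/-- **`H¹(kerD κ v, M) ≃+ H¹(ker κ ⊓ D_v, M)`** for any `ℤ_p`-extension `κ`, any discrete `Γ_K`-module
`M` and any finite `v` (the two inflations along the tautological isomorphisms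
`kerD κ v ⇄ ker κ ⊓ D_v`, as used inline in the tree's `UniversalToricDescentLocalH1DivisibleCurve`).
[cite: Greenberg1989, §1 p. 98] [cite: SerreGaloisCohomology1997, I §2.4] -/
theorem nonempty_addEquiv_subgroupH1_kerD {p : ℕ} [Fact p.Prime] (κ : ZpExtension K p)
    (M : Type) [AddCommGroup M] [DistribMulAction (absoluteGaloisGroup K) M] [TopologicalSpace M]
    [DiscreteTopology M] (v : HeightOneSpectrum (𝓞 K)) :
    Nonempty (Literature.NumberTheory.EllipticCurves.subgroupH1 (kerD κ v) M ≃+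
      Literature.NumberTheory.EllipticCurves.subgroupH1 (κ.kerSubgroup ⊓ decomp v) M) := by
  let D : Subgroup (absoluteGaloisGroup K) := κ.kerSubgroup ⊓ decomp v
  let θ₃ : kerD κ v →ₜ* D :=
    { toFun := fun x ↦ ⟨((x : decomp (K := K) v) : absoluteGaloisGroup K),
        Subgroup.mem_inf.mpr ⟨(mem_kerD_iff κ v _).1 x.2, (x : decomp (K := K) v).2⟩⟩
      map_one' := rfl
      map_mul' := fun _ _ ↦ rfl
      continuous_toFun := (continuous_subtype_val.comp continuous_subtype_val).subtype_mk _ }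
  let θ₄ : D →ₜ* kerD κ v :=
    { toFun := fun x ↦ ⟨⟨(x : absoluteGaloisGroup K), (Subgroup.mem_inf.mp x.2).2⟩,
        (mem_kerD_iff κ v _).2 (Subgroup.mem_inf.mp x.2).1⟩
      map_one' := rfl
      map_mul' := fun _ _ ↦ rfl
      continuous_toFun := (continuous_subtype_val.subtype_mk _).subtype_mk _ }
  have hθ₄₃ : θ₄.comp θ₃ = ContinuousMonoidHom.id (kerD κ v) := ContinuousMonoidHom.ext fun _ ↦ rfl
  have hθ₃₄ : θ₃.comp θ₄ = ContinuousMonoidHom.id D := ContinuousMonoidHom.ext fun _ ↦ rfl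
  let r₃ := resH1Hom θ₃ (AddMonoidHom.id M) fun x m ↦ (rfl : θ₃ x • m = x • m)
  let r₄ := resH1Hom θ₄ (AddMonoidHom.id M) fun x m ↦ (rfl : θ₄ x • m = x • m)
  have h34 : r₃.comp r₄ = AddMonoidHom.id _ := by
    rw [resH1Hom_comp, resH1Hom_congr hθ₄₃ (AddMonoidHom.comp_id _) _ (fun _ _ ↦ rfl), resH1Hom_id]
  have h43 : r₄.comp r₃ = AddMonoidHom.id _ := by
    rw [resH1Hom_comp, resH1Hom_congr hθ₃₄ (AddMonoidHom.comp_id _) _ (fun _ _ ↦ rfl), resH1Hom_id]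
  exact ⟨{ toFun := r₄
           invFun := r₃
           left_inv := fun x ↦ DFunLike.congr_fun h34 x
           right_inv := fun y ↦ DFunLike.congr_fun h43 y
           map_add' := fun x y ↦ map_add r₄ x y }⟩

/-- **`corank_{ℤ_p} H¹(kerD κ v, M) = corank_{ℤ_p} H¹(ker κ ⊓ D_v, M)`**.
[cite: Greenberg1989, §1 p. 98] -/
theorem zpCorank_subgroupH1_kerD_eq {p : ℕ} [Fact p.Prime] (κ : ZpExtension K p)
    (M : Type) [AddCommGroup M] [DistribMulAction (absoluteGaloisGroup K) M] [TopologicalSpace M]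
    [DiscreteTopology M] (v : HeightOneSpectrum (𝓞 K)) (q : ℕ) :
    zpCorank (Literature.NumberTheory.EllipticCurves.subgroupH1 (kerD κ v) M) q =
      zpCorank (Literature.NumberTheory.EllipticCurves.subgroupH1 (κ.kerSubgroup ⊓ decomp v) M) q := by
  obtain ⟨e⟩ := nonempty_addEquiv_subgroupH1_kerD κ M v
  exact zpCorank_congr e q

/-! ## §2 The local corank at a place with `θ(Frob_v) ≡ Nv (mod 𝔭)` -/

section Character

variable {p : ℕ} [hp : Fact p.Prime]
  (θ : FramedGaloisRep K (padicCoeffIntegers (∅ : Set (PadicAlgCl p))) 1) (κ : ZpExtension K p)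
  {v : HeightOneSpectrum (𝓞 K)}

/-- `D_v ⊄ ker κ` in the local currency: some `σ ∈ Γ_{K_v}` restricts outside `ker κ`
(`D_v = res Γ_{K_v}`). [cite: NeukirchANT1999, Ch. II §9 Prop. (9.6)] -/
theorem exists_not_mem_localSubgroup_of_not_decomp_le (hD : ¬ (decomp v ≤ κ.kerSubgroup)) :
    ∃ σ : absoluteGaloisGroup (v.adicCompletion K),
      σ ∉ localSubgroup κ.kerSubgroup (v.adicCompletion K) := by
  by_contra hall
  refine hD fun g hg ↦ ?_
  obtain ⟨σ, rfl⟩ := (mem_decomp_iff v g).mp hg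
  have hσ : σ ∈ localSubgroup κ.kerSubgroup (v.adicCompletion K) := not_not.mp fun h ↦ hall ⟨σ, h⟩
  have h := (mem_localSubgroup_iff κ.kerSubgroup (v.adicCompletion K) σ).mp hσ
  rwa [resGal_eq_absGaloisRestrict] at h

/-- **KY / CGLS Lemma 1.1.1 per place of `K_∞`, lower-bound half, global currency:
`corank_{ℤ_p} H¹(ker κ ⊓ D_v, (F/𝒪)(θ)) = 1`** for any `ℤ_p`-extension `κ` of the number field `K`,
a place `v ∤ p` finitely decomposed in `K_∞` (`D_v ⊄ ker κ`), and a character `θ` with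
`θ^{p−1} = 1`, unramified at `v` with `θ(Frob_v) ≡ Nv (mod 𝔭)` (`FrobActsAsNormAt ∅ θ v`). Here
`H¹(ker κ ⊓ D_v, M) = H¹(K_{∞,w₀}, M)` at the place `w₀` of `K_∞` singled out by the chosen
embedding (PW's `localH1`, the target of Greenberg's `awayKer`); the value `1` at each of the
`[Γ:Γ_w]` places above `v` is KY's `λ(𝒫_w(θ)) = [Γ:Γ_w]·𝟙[θ(Frob_w) ≡ ℓ]` ("`H¹(K_w, M_θ)^∨` is
`Λ`-torsion with characteristic ideal `(𝒫_w(θ))`"). Transport of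
`CharLocalTameCount.zpCorank_subgroupH1_localSubgroup_charModule_eq_one` along §1.
[cite: KellerYin2024, Lemma 1.1.1 (arXiv:2402.12781v2 TeX L455–462)] [cite: CastellaGrossiLeeSkinner2022, Lemma 1.1.1]
[cite: GreenbergVatsal2000, §2 Prop. (2.4) (p. 22)] -/
theorem zpCorank_localH1_charModule_eq_one (hθ : ∀ σ : absoluteGaloisGroup K, θ σ ^ (p - 1) = 1)
    (hpv : (p : 𝓞 K) ∉ v.asIdeal) (hD : ¬ (decomp v ≤ κ.kerSubgroup))
    (hF : FrobActsAsNormAt (∅ : Set (PadicAlgCl p)) θ v) :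
    zpCorank (Literature.NumberTheory.EllipticCurves.subgroupH1 (κ.kerSubgroup ⊓ decomp v)
      (charModule (∅ : Set (PadicAlgCl p)) θ)) p = 1 := by
  rw [zpCorank_subgroupH1_inf_decomp_eq κ.kerSubgroup (charModule (∅ : Set (PadicAlgCl p)) θ) v p]
  exact zpCorank_subgroupH1_localSubgroup_charModule_eq_one θ κ hθ hpv
    (exists_not_mem_localSubgroup_of_not_decomp_le κ hD) hF

/-- **The per-place LOWER bound of KY Lemma 1.1.1, unconditionally in the ramification of `θ`:
`𝟙[FrobActsAsNormAt ∅ θ v] ≤ corank_{ℤ_p} H¹(ker κ ⊓ D_v, (F/𝒪)(θ))`** (any `ℤ_p`-extension, `v ∤ p`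
finitely decomposed, `θ^{p−1} = 1`). Summed over the `numPlacesAbove κ w` places of `K_∞` above
each `w ∈ Sf` this is `Σ_{w∈Sf} charLocalLambda ∅ κ θ w ≤ Σ_w corank ℋ_w`, the local input of the
`≥` half of `KellerYin2024.prop125_residualPair_unrSelmer_corank_ge` (the global input being the
surjectivity of the global-to-local map, Greenberg 2016 Prop. 2.6.3 / Pollack–Weston 2011 Prop. A.2);
the matching upper bound is `CharLocalInertiaFrobenius.zpCorank_le_ite_of_forall_exists`.
[cite: KellerYin2024, Lemma 1.1.1 (arXiv:2402.12781v2 TeX L455–462) and Prop. 1.2.5 (L780–800)]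
[cite: CastellaGrossiLeeSkinner2022, Lemma 1.1.1] [cite: GreenbergVatsal2000, §2 Prop. (2.4) (p. 22)] -/
theorem ite_le_zpCorank_localH1_charModule (hθ : ∀ σ : absoluteGaloisGroup K, θ σ ^ (p - 1) = 1)
    (hpv : (p : 𝓞 K) ∉ v.asIdeal) (hD : ¬ (decomp v ≤ κ.kerSubgroup)) :
    (if FrobActsAsNormAt (∅ : Set (PadicAlgCl p)) θ v then 1 else 0) ≤
      zpCorank (Literature.NumberTheory.EllipticCurves.subgroupH1 (κ.kerSubgroup ⊓ decomp v)
        (charModule (∅ : Set (PadicAlgCl p)) θ)) p := by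
  split_ifs with hF
  · exact (zpCorank_localH1_charModule_eq_one θ κ hθ hpv hD hF).ge
  · exact Nat.zero_le _

/-- **`charLocalLambda ∅ κ θ v ≤ numPlacesAbove κ v · corank_{ℤ_p} H¹(ker κ ⊓ D_v, (F/𝒪)(θ))`**
(`charLocalLambda = numPlacesAbove · 𝟙[FrobActsAsNormAt]`; same hypotheses) — the lower bound in
the currency of `KellerYin2024.charLocalLambda`. [cite: KellerYin2024, Lemma 1.1.1 (arXiv:2402.12781v2 TeX L455–462)] -/
theorem charLocalLambda_le_numPlacesAbove_mul_zpCorank_localH1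
    (hθ : ∀ σ : absoluteGaloisGroup K, θ σ ^ (p - 1) = 1)
    (hpv : (p : 𝓞 K) ∉ v.asIdeal) (hD : ¬ (decomp v ≤ κ.kerSubgroup)) :
    charLocalLambda (∅ : Set (PadicAlgCl p)) κ θ v ≤
      numPlacesAbove κ v *
        zpCorank (Literature.NumberTheory.EllipticCurves.subgroupH1 (κ.kerSubgroup ⊓ decomp v)
          (charModule (∅ : Set (PadicAlgCl p)) θ)) p := by
  rw [charLocalLambda]
  exact Nat.mul_le_mul_left _ (ite_le_zpCorank_localH1_charModule θ κ hθ hpv hD)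

/-- **`corank_{ℤ_p} H¹(kerD κ v, (F/𝒪)(θ)) = 1`** under the hypotheses of
`zpCorank_localH1_charModule_eq_one` (the `kerD` currency of the UTD Σ-local files).
[cite: KellerYin2024, Lemma 1.1.1 (arXiv:2402.12781v2 TeX L455–462)] [cite: GreenbergVatsal2000, §2 Prop. (2.4) (p. 22)] -/
theorem zpCorank_subgroupH1_kerD_charModule_eq_one (hθ : ∀ σ : absoluteGaloisGroup K, θ σ ^ (p - 1) = 1)
    (hpv : (p : 𝓞 K) ∉ v.asIdeal) (hD : ¬ (decomp v ≤ κ.kerSubgroup))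
    (hF : FrobActsAsNormAt (∅ : Set (PadicAlgCl p)) θ v) :
    zpCorank (Literature.NumberTheory.EllipticCurves.subgroupH1 (kerD κ v)
      (charModule (∅ : Set (PadicAlgCl p)) θ)) p = 1 := by
  rw [zpCorank_subgroupH1_kerD_eq κ (charModule (∅ : Set (PadicAlgCl p)) θ) v p]
  exact zpCorank_localH1_charModule_eq_one θ κ hθ hpv hD hF

/-- **`𝟙[FrobActsAsNormAt ∅ θ v] ≤ corank_{ℤ_p} H¹(kerD κ v, (F/𝒪)(θ))`** (`kerD` currency of
`ite_le_zpCorank_localH1_charModule`). [cite: KellerYin2024, Lemma 1.1.1 (arXiv:2402.12781v2 TeX L455–462)] -/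
theorem ite_le_zpCorank_subgroupH1_kerD_charModule
    (hθ : ∀ σ : absoluteGaloisGroup K, θ σ ^ (p - 1) = 1)
    (hpv : (p : 𝓞 K) ∉ v.asIdeal) (hD : ¬ (decomp v ≤ κ.kerSubgroup)) :
    (if FrobActsAsNormAt (∅ : Set (PadicAlgCl p)) θ v then 1 else 0) ≤
      zpCorank (Literature.NumberTheory.EllipticCurves.subgroupH1 (kerD κ v)
        (charModule (∅ : Set (PadicAlgCl p)) θ)) p := by
  rw [zpCorank_subgroupH1_kerD_eq κ (charModule (∅ : Set (PadicAlgCl p)) θ) v p]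
  exact ite_le_zpCorank_localH1_charModule θ κ hθ hpv hD

/-! ## §3 `H¹(ker κ ⊓ D_v, (F/𝒪)(θ))` is `p`-divisible -/

/-- **`H¹(ker κ ⊓ D_v, (F/𝒪)(θ))` is `p`-divisible** at `v ∤ p` finitely decomposed in the
`ℤ_p`-extension (transport of `CharLocalTameCount.exists_nsmul_eq_subgroupH1_localSubgroup_charModule`
along §1): the "`μ = 0`" clause of KY Lemma 1.1.1 at the chosen place of `K_∞`.
[cite: KellerYin2024, Lemma 1.1.1 (arXiv:2402.12781v2 TeX L455–462)] [cite: GreenbergVatsal2000, §2 Prop. (2.4) (p. 22)] -/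
theorem exists_nsmul_eq_localH1_charModule (hpv : (p : 𝓞 K) ∉ v.asIdeal)
    (hD : ¬ (decomp v ≤ κ.kerSubgroup))
    (x : Literature.NumberTheory.EllipticCurves.subgroupH1 (κ.kerSubgroup ⊓ decomp v)
      (charModule (∅ : Set (PadicAlgCl p)) θ)) :
    ∃ x' : Literature.NumberTheory.EllipticCurves.subgroupH1 (κ.kerSubgroup ⊓ decomp v)
      (charModule (∅ : Set (PadicAlgCl p)) θ), p • x' = x := by
  obtain ⟨e⟩ := nonempty_addEquiv_subgroupH1_inf_decomp κ.kerSubgroup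
    (charModule (∅ : Set (PadicAlgCl p)) θ) v
  obtain ⟨y, hy⟩ := exists_nsmul_eq_subgroupH1_localSubgroup_charModule θ κ hpv
    (exists_not_mem_localSubgroup_of_not_decomp_le κ hD) (e x)
  refine ⟨e.symm y, e.injective ?_⟩
  rw [map_nsmul, e.apply_symm_apply, hy]

end Character

end Summit.BirchSwinnertonDyer.BirchSwinnertonDyer.Theorems.CharLocalTameCorank

end
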